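import Mathlib.GroupTheory.FreeGroup.GeneratorEquiv
import Literature.GroupTheory.CombinatorialGroupTheory.FreeGroupoidTreeBasis
import Literature.GroupTheory.CombinatorialGroupTheory.FreeGroupoidIsFree
import Literature.AnabelianGeometry.SemiGraphs.FundamentalGroup
import HarnessLib

/-!
# Finite rank of the vertex groups of a free groupoid with finitely many generating arrows

Topic `Literature/GroupTheory/CombinatorialGroupTheory`; PROOF-ONLY (no definitions).  Classical
bookkeeping: the fundamental group of a FINITE connected graph is free of finite rank
(`|E| - |V| + 1`); R. C. Lyndon, P. E. Schupp, *Combinatorial Group Theory*, Ch. I Prop. 3.7 (the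
Schreier / spanning-tree basis), J.-P. Serre, *Trees*, I §3 Prop. 15 / §4.1 Thm. 4, J. Stallings,
*Topology of finite graphs*, §2.  In the tree the spanning-tree basis of the vertex group at the root
of an arborescence of a free groupoid is the DATUM `FreeGroupoidTree.treeBasis T : FreeGroupBasis
(LoopIndex T) (End (rootObj T))` (`FreeGroupoidTreeBasis.lean`), indexed by the generating arrows
outside the tree; so when the generating quiver has finitely many arrows the rank is finite.  We
record:

* `IsFreeGroup.finite_generators_of_basis` — a free basis on a finite type makes Mathlib's chosen
  generating type `IsFreeGroup.Generators G` finite (rank invariance, Mathlib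
  `Equiv.ofFreeGroupEquiv`);
* `FreeGroupoidTree.finite_generators_end_rootObj` — for an arborescence `T` of the (symmetrised)
  generating quiver of a free groupoid `Y` with `Finite (Quiver.Total (Generators Y))`, the vertex
  group `End (rootObj T)` is free with finitely many generators;
* `IsFreeGroupoid.exists_isFreeGroup_finite_generators_end` — the same at ANY object `r` from which
  every object receives a morphism (spanning tree = Mathlib's geodesic arborescence rooted at `r`),
  and `…_vertexGroup` for the vertex group `r ⟶ r` (Mathlib `Groupoid.vertexGroup`, isomorphic to
  `End r` through `x ↦ x⁻¹`);
* `SemiGraph.exists_isFreeGroup_finite_generators_fundamentalGroup` — for a semi-graph with finitely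
  many branches, the (topological) fundamental group `π₁(𝔾, c)` of
  `Literature.AnabelianGeometry.SemiGraphs.FundamentalGroup` at a component `c` from which every
  component is reachable in the fundamental groupoid is free of finite rank ([SemiAnbd] §1 p. 20
  "the fundamental group of any graph is free", here with the finiteness of the rank for finite
  graphs, used on p. 38–39 for the graphs `𝔾_i` of finite étale coverings).

No new mathematics; nothing here takes a side on any disputed claim.
-/

namespace Literature.GroupTheory.CombinatorialGroupTheory

open CategoryTheory Quiver IsFreeGroupoid

universe u

/-- **Rank invariance, finite case.** If a group `G` has a free basis indexed by a finite type `ι`,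
then Mathlib's chosen generating type `IsFreeGroup.Generators G` (for the free-group structure that
basis defines) is finite: `ι ≃ Generators G` by `Equiv.ofFreeGroupEquiv`.
[cite: LyndonSchupp2001, Ch. I Prop. 3.7] -/
theorem IsFreeGroup.finite_generators_of_basis {G : Type u} [Group G] {ι : Type u} [Finite ι]
    (b : FreeGroupBasis ι G) :
    ∃ _ : _root_.IsFreeGroup G, Finite (_root_.IsFreeGroup.Generators G) := by
  haveI : _root_.IsFreeGroup G := b.isFreeGroup
  exact ⟨inferInstance, Finite.of_equiv ι
    (Equiv.ofFreeGroupEquiv (b.repr.symm.trans (_root_.IsFreeGroup.toFreeGroup G)))⟩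

section FreeGroupoid

variable {Y : Type u} [Groupoid.{u} Y] [IsFreeGroupoid Y]

/-- The index type of the spanning-tree basis — the generating arrows outside the tree — is finite
when the generating quiver has finitely many arrows. [cite: LyndonSchupp2001, Ch. I Prop. 3.7] -/
theorem FreeGroupoidTree.finite_loopIndex (T : WideSubquiver (Symmetrify (Generators Y)))
    [Finite (Quiver.Total (Generators Y))] : Finite (FreeGroupoidTree.LoopIndex T) :=
  Subtype.finite

/-- **The vertex group at the root of an arborescence of a free groupoid with finitely many
generating arrows is free of finite rank** (Schreier's spanning-tree basis, Lyndon–Schupp Ch. I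
Prop. 3.7 (2): the basis is indexed by the generating arrows not in the tree).
[cite: LyndonSchupp2001, Ch. I Prop. 3.7] -/
theorem FreeGroupoidTree.finite_generators_end_rootObj
    (T : WideSubquiver (Symmetrify (Generators Y))) [Arborescence T]
    [Finite (Quiver.Total (Generators Y))] :
    ∃ _ : _root_.IsFreeGroup (End (FreeGroupoidTree.rootObj T)),
      Finite (_root_.IsFreeGroup.Generators (End (FreeGroupoidTree.rootObj T))) := by
  haveI := FreeGroupoidTree.finite_loopIndex T
  exact IsFreeGroup.finite_generators_of_basis (FreeGroupoidTree.treeBasis T)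

/-- If every object of a free groupoid receives a morphism from `r`, the symmetrised generating
quiver is rooted-connected at `r` (Mathlib `IsFreeGroupoid.path_nonempty_of_hom`).
[cite: LyndonSchupp2001, Ch. I Prop. 3.7] -/
theorem IsFreeGroupoid.rootedConnected_of_nonempty_hom (r : Y) (h : ∀ a : Y, Nonempty (r ⟶ a)) :
    RootedConnected (show Symmetrify (Generators Y) from r) :=
  ⟨fun b => IsFreeGroupoid.path_nonempty_of_hom (h b)⟩

/-- **The vertex group of a free groupoid with finitely many generating arrows, at an object from
which every object is reachable, is free of finite rank** (spanning tree = the geodesic arborescence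
rooted at `r`). [cite: LyndonSchupp2001, Ch. I Prop. 3.7] -/
theorem IsFreeGroupoid.exists_isFreeGroup_finite_generators_end (r : Y)
    (h : ∀ a : Y, Nonempty (r ⟶ a)) [Finite (Quiver.Total (Generators Y))] :
    ∃ _ : _root_.IsFreeGroup (End r), Finite (_root_.IsFreeGroup.Generators (End r)) := by
  haveI := IsFreeGroupoid.rootedConnected_of_nonempty_hom r h
  exact FreeGroupoidTree.finite_generators_end_rootObj
    (Quiver.geodesicSubtree (show Symmetrify (Generators Y) from r))

/-- Transfer of "free of finite rank" along a group isomorphism.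
[cite: LyndonSchupp2001, Ch. I Prop. 3.7] -/
theorem IsFreeGroup.exists_isFreeGroup_finite_generators_of_mulEquiv {G H : Type u} [Group G]
    [Group H] (e : G ≃* H) (hG : ∃ _ : _root_.IsFreeGroup G, Finite (_root_.IsFreeGroup.Generators G)) :
    ∃ _ : _root_.IsFreeGroup H, Finite (_root_.IsFreeGroup.Generators H) := by
  obtain ⟨hfree, hfin⟩ := hG
  exact IsFreeGroup.finite_generators_of_basis ((_root_.IsFreeGroup.basis G).map e)

/-- The same for the VERTEX GROUP `r ⟶ r` (Mathlib `Groupoid.vertexGroup`, multiplication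
`x * y = x ≫ y`), which is anti-isomorphic — hence, through `x ↦ x⁻¹`, isomorphic — to `End r`
(multiplication `x * y = y ≫ x`). [cite: LyndonSchupp2001, Ch. I Prop. 3.7] -/
theorem IsFreeGroupoid.exists_isFreeGroup_finite_generators_vertexGroup (r : Y)
    (h : ∀ a : Y, Nonempty (r ⟶ a)) [Finite (Quiver.Total (Generators Y))] :
    ∃ _ : _root_.IsFreeGroup (r ⟶ r), Finite (_root_.IsFreeGroup.Generators (r ⟶ r)) := by
  -- `x ↦ x⁻¹ : End r ≃* (r ⟶ r)` (inversion turns the opposite multiplication into the direct one)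
  let e : End r ≃* (r ⟶ r) :=
    { toFun := fun x => Groupoid.inv x
      invFun := fun x => Groupoid.inv x
      left_inv := fun x => by
        change Groupoid.inv (Groupoid.inv x) = x
        simp only [Groupoid.inv_eq_inv, IsIso.inv_inv]
      right_inv := fun x => by
        change Groupoid.inv (Groupoid.inv x) = x
        simp only [Groupoid.inv_eq_inv, IsIso.inv_inv]
      map_mul' := fun x y => by
        change Groupoid.inv (y ≫ x) = Groupoid.inv x ≫ Groupoid.inv y
        simp only [Groupoid.inv_eq_inv, IsIso.inv_comp] }
  exact IsFreeGroup.exists_isFreeGroup_finite_generators_of_mulEquiv e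
    (IsFreeGroupoid.exists_isFreeGroup_finite_generators_end r h)

end FreeGroupoid

/-! ### The fundamental group of a finite semi-graph -/

section SemiGraph

open Literature.AnabelianGeometry.SemiGraphs

variable (G : Literature.AnabelianGeometry.SemiGraphs.SemiGraph.{u})

/-- The generating arrows of the fundamental groupoid of a semi-graph are (copies of) its abutting
branches: a semi-graph with finitely many branches has finitely many generating arrows.
[cite: MochizukiSemiAnbd2006, Def. 2.11 p.32] -/
theorem SemiGraph.finite_total_generators_fundamentalGroupoid [Finite G.Branch] :
    Finite (Quiver.Total (Generators G.FundamentalGroupoid)) := by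
  classical
  -- send a generating arrow `inr e ⟶ inl v` (a branch `b` of `e` abutting to `v`) to `b`
  let f : Quiver.Total (Generators G.FundamentalGroupoid) → G.Branch := fun t =>
    match t with
    | ⟨⟨Sum.inr _⟩, ⟨Sum.inl _⟩, ⟨b⟩⟩ => b.1
    | ⟨⟨Sum.inl _⟩, ⟨Sum.inl _⟩, ⟨b⟩⟩ => PEmpty.elim b
    | ⟨⟨Sum.inl _⟩, ⟨Sum.inr _⟩, ⟨b⟩⟩ => PEmpty.elim b
    | ⟨⟨Sum.inr _⟩, ⟨Sum.inr _⟩, ⟨b⟩⟩ => PEmpty.elim b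
  refine Finite.of_injective f ?_
  rintro ⟨⟨a⟩, ⟨a'⟩, ⟨b⟩⟩ ⟨⟨c⟩, ⟨c'⟩, ⟨d⟩⟩ hbd
  rcases a with v | e <;> rcases a' with v' | e' <;> try exact PEmpty.elim b
  rcases c with w | g <;> rcases c' with w' | g' <;> try exact PEmpty.elim d
  rcases b with ⟨b, hbe, hbv⟩
  rcases d with ⟨d, hde, hdv⟩
  change b = d at hbd
  subst hbd
  obtain rfl : e = g := hbe.symm.trans hde
  obtain rfl : v' = w' := Option.some_injective _ (hbv.symm.trans hdv)
  rfl

/-- **The fundamental group of a semi-graph with finitely many branches is free of finite rank** at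
any component `c` from which every component is reachable in the fundamental groupoid (e.g. any
component of a connected finite semi-graph): [SemiAnbd] §1 p. 20 "the fundamental group of any graph
is free", with the finiteness of the rank (Serre, *Trees*, I §3; Lyndon–Schupp Ch. I Prop. 3.7) that
p. 38–39 use for the underlying graphs `𝔾_i` of finite étale coverings.
[cite: MochizukiSemiAnbd2006, §1 p.20] -/
theorem SemiGraph.exists_isFreeGroup_finite_generators_fundamentalGroup [Finite G.Branch]
    (c : G.CatCarrier) (hc : ∀ a : G.CatCarrier, Nonempty (G.basept c ⟶ G.basept a)) :
    ∃ _ : _root_.IsFreeGroup (G.FundamentalGroup c),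
      Finite (_root_.IsFreeGroup.Generators (G.FundamentalGroup c)) := by
  haveI := SemiGraph.finite_total_generators_fundamentalGroupoid G
  have h : ∀ a : G.FundamentalGroupoid, Nonempty (G.basept c ⟶ a) := fun a => hc a.as
  exact IsFreeGroupoid.exists_isFreeGroup_finite_generators_vertexGroup (G.basept c) h

end SemiGraph

end Literature.GroupTheory.CombinatorialGroupTheory

-- (build enqueue re-land 2026-08-26T07:15Z: comment-only; declarations byte-identical to p427710)
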